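import Literature.Probability.RandomPlanarGeometry.SAWRestrictionCovariance
import Literature.Probability.RandomPlanarGeometry.SAWEdgeListSurgery
import HarnessLib

/-!
# One fibre of the two-sided domain Markov property of the critical planar SAW

Summit `CriticalPhenomena`, notion `SAWScalingLimit`, thesis `SAWRestrictionRigidity.EventualTight`
(line Sketch v6, stub `stub_arcFibre`, V1a).  The COMBINATORIAL HALF of the two-sided domain
Markov property of the critical self-avoiding walk of a discrete domain `Ω_δ ⊆ δℤ²`
(Duminil-Copin–Smirnov 2012, §2; Madras–Slade 1993, §1.2) on ONE fibre: fix a witness SAW `γ₀`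
of `Ω_δ` from `a₀` to `b₀` whose support reads `β ++ α₀ ++ β'` with the middle piece `α₀`
running from `c` to `c'`.

* **Cutting** (`arcFibre_cut`): a SAW `γ` whose support reads `β ++ α ++ β'` with `α` from `c`
  to `c'` determines the self-avoiding arc `c → c'` of `Ω_δ` with support `α`, which avoids `β`
  and `β'`, and `|γ| = |β| + |β'| + |arc|`;
* **Gluing** (`arcFibre_glue`): conversely every self-avoiding arc `p : c → c'` of `Ω_δ` avoiding
  `β` and `β'` glues with the outer pieces of `γ₀` to a SAW of `Ω_δ` from `a₀` to `b₀` with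
  support `β ++ p.support ++ β'` (`SAW.isChain_splice`, `SAW.nodup_splice`);
* **`stub_arcFibre`**: the two resulting inequalities between critical weights
  `x_c^{|γ|}` summed over the fibre (with an arbitrary constraint `A` on the middle piece) and
  `x_c^{|β|+|β'|} ·` (the weights `x_c^{|p|}` summed over the arcs), by injectivity of both maps
  (`Summable.tsum_le_tsum_of_inj`).
-/

noncomputable section

open MeasureTheory Filter Topology Set Metric
open scoped ENNReal NNReal
open Literature.Probability.RandomPlanarGeometry Literature.Probability.LatticeModels

namespace Summit.CriticalPhenomena.SAWScalingLimit.Theorems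

/-- Factorisation of critical weights in `[0, ∞]`: `x_c^{n+m} = x_c^n · x_c^m` (as
`x_c = μ⁻¹ ≥ 0`, `μ` being an infimum of nonnegative reals; cf. `xc_nonneg` in
`BoundaryTP2Negative_Box3.lean`, not imported to keep this leaf light). [folklore] -/
theorem arcFibre_ofReal_pow_add (n m : ℕ) :
    ENNReal.ofReal (SAW.criticalFugacity ^ (n + m)) =
      ENNReal.ofReal (SAW.criticalFugacity ^ n) * ENNReal.ofReal (SAW.criticalFugacity ^ m) := by
  have h0 : 0 ≤ SAW.criticalFugacity := by
    rw [SAW.criticalFugacity, inv_nonneg, SAW.connectiveConstant]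
    exact Real.iInf_nonneg fun n => Real.rpow_nonneg (Nat.cast_nonneg _) _
  rw [pow_add, ENNReal.ofReal_mul (pow_nonneg h0 n)]

/-- **Cutting a SAW of `Ω_δ` at a middle piece.** If the support of the SAW `γ` of `Ω_δ` reads
`β ++ α ++ β'` with `α` running from `c` to `c'`, then `α` is the support of a self-avoiding arc
of `Ω_δ` from `c` to `c'` avoiding `β` and `β'`, and `|γ| = |β| + |β'| + |arc|`.
[cite: DuminilCopinSmirnov2012, §2] -/
theorem arcFibre_cut {Ω : Set ℂ} {δ : ℝ} {a₀ b₀ : Site 2} (γ : SAW.DomainSAW Ω δ a₀ b₀)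
    {β α β' : List (Site 2)} {c c' : Site 2} (hγ : γ.walk.support = β ++ α ++ β')
    (hc : α.head? = some c) (hc' : α.getLast? = some c') :
    ∃ p : (discreteDomainGraph Ω δ).Walk c c', p.IsPath ∧ (∀ v ∈ p.support, v ∉ β ∧ v ∉ β') ∧
      p.support = α ∧ γ.length = β.length + β'.length + p.length := by
  have hne : α ≠ [] := by rintro rfl; simp at hc
  have hchain : α.IsChain (discreteDomainGraph Ω δ).Adj := by
    have h := γ.walk.isChain_adj_support
    rw [hγ] at h
    exact h.left_of_append.right_of_append
  have hnd : (β ++ α ++ β').Nodup := hγ ▸ γ.isPath.support_nodup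
  have hh : α.head hne = c := (List.head_eq_iff_head?_eq_some hne).2 hc
  have hl : α.getLast hne = c' := (List.getLast_eq_iff_getLast?_eq_some hne).2 hc'
  refine ⟨(SimpleGraph.Walk.ofSupport α hne hchain).copy hh hl, ?_, ?_, ?_, ?_⟩
  · refine SimpleGraph.Walk.IsPath.mk' ?_
    rw [SimpleGraph.Walk.support_copy, SimpleGraph.Walk.support_ofSupport]
    exact hnd.of_append_left.of_append_right
  · intro v hv
    rw [SimpleGraph.Walk.support_copy, SimpleGraph.Walk.support_ofSupport] at hv
    rw [List.nodup_append, List.nodup_append] at hnd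
    obtain ⟨⟨-, -, hβα⟩, -, hαβ'⟩ := hnd
    exact ⟨fun hβ => hβα v hβ v hv rfl, fun hβ' => hαβ' v (List.mem_append_right β hv) v hβ' rfl⟩
  · rw [SimpleGraph.Walk.support_copy, SimpleGraph.Walk.support_ofSupport]
  · change γ.walk.length = _
    rw [SimpleGraph.Walk.length_copy, SimpleGraph.Walk.length_ofSupport]
    have h1 := congrArg List.length hγ
    rw [SimpleGraph.Walk.length_support, List.length_append, List.length_append] at h1
    have h2 : 0 < α.length := List.length_pos_iff.2 hne
    omega

/-- **Gluing an arc into the outer pieces of a SAW of `Ω_δ`.** If the support of the SAW `γ₀` of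
`Ω_δ` from `a₀` to `b₀` reads `β ++ α₀ ++ β'` with `α₀` running from `c` to `c'`, then for every
self-avoiding arc `p` of `Ω_δ` from `c` to `c'` avoiding `β` and `β'` the list
`β ++ p.support ++ β'` is the support of a SAW of `Ω_δ` from `a₀` to `b₀`, of length
`|β| + |β'| + |p|`. [cite: DuminilCopinSmirnov2012, §2] -/
theorem arcFibre_glue {Ω : Set ℂ} {δ : ℝ} {a₀ b₀ : Site 2} (γ₀ : SAW.DomainSAW Ω δ a₀ b₀)
    {β α₀ β' : List (Site 2)} {c c' : Site 2} (hγ₀ : γ₀.walk.support = β ++ α₀ ++ β')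
    (hc : α₀.head? = some c) (hc' : α₀.getLast? = some c')
    (p : (discreteDomainGraph Ω δ).Walk c c') (hp : p.IsPath)
    (hpβ : ∀ v ∈ p.support, v ∉ β ∧ v ∉ β') :
    ∃ γ : SAW.DomainSAW Ω δ a₀ b₀, γ.walk.support = β ++ p.support ++ β' ∧
      γ.length = β.length + β'.length + p.length := by
  have hph : p.support.head? = some c := by
    rw [List.head?_eq_some_head p.support_ne_nil, SimpleGraph.Walk.head_support]
  have hpl : p.support.getLast? = some c' := by
    rw [List.getLast?_eq_some_getLast p.support_ne_nil, SimpleGraph.Walk.getLast_support]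
  have hne : β ++ p.support ++ β' ≠ [] := by simp
  have hchain : (β ++ p.support ++ β').IsChain (discreteDomainGraph Ω δ).Adj :=
    SAW.isChain_splice (hγ₀ ▸ γ₀.walk.isChain_adj_support) p.isChain_adj_support hc hph hc' hpl
  have hnd : (β ++ p.support ++ β').Nodup :=
    SAW.nodup_splice (hγ₀ ▸ γ₀.isPath.support_nodup) hp.support_nodup (fun v hv => (hpβ v hv).1)
      (fun v hv => (hpβ v hv).2)
  have ha : (β ++ p.support ++ β').head hne = a₀ := by
    rw [List.head_eq_iff_head?_eq_some, SAW.head?_splice_mid hc hph, ← hγ₀,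
      List.head?_eq_some_head γ₀.walk.support_ne_nil, SimpleGraph.Walk.head_support]
  have hb : (β ++ p.support ++ β').getLast hne = b₀ := by
    rw [List.getLast_eq_iff_getLast?_eq_some, SAW.getLast?_splice_mid hc' hpl, ← hγ₀,
      List.getLast?_eq_some_getLast γ₀.walk.support_ne_nil, SimpleGraph.Walk.getLast_support]
  refine ⟨⟨(SimpleGraph.Walk.ofSupport _ hne hchain).copy ha hb, SimpleGraph.Walk.IsPath.mk' ?_⟩,
    ?_, ?_⟩
  · rw [SimpleGraph.Walk.support_copy, SimpleGraph.Walk.support_ofSupport]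
    exact hnd
  · change ((SimpleGraph.Walk.ofSupport _ hne hchain).copy ha hb).support = _
    rw [SimpleGraph.Walk.support_copy, SimpleGraph.Walk.support_ofSupport]
  · change ((SimpleGraph.Walk.ofSupport _ hne hchain).copy ha hb).length = _
    rw [SimpleGraph.Walk.length_copy, SimpleGraph.Walk.length_ofSupport, List.length_append,
      List.length_append, SimpleGraph.Walk.length_support]
    omega

/-- **One fibre of the two-sided domain Markov property of the critical planar SAW**
(combinatorial half, as two inequalities between critical weights). Fix a SAW `γ₀` of `Ω_δ` from
`a₀` to `b₀` whose support reads `β ++ α₀ ++ β'` with `α₀` from `c` to `c'`, and a constraint `A`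
on vertex lists. (i) Cutting: the SAWs `γ` whose support reads `β ++ α ++ β'` with `α` from `c`
to `c'` and `A α` weigh at most `x_c^{|β|+|β'|}` times the mass `∑ x_c^{|p|}` of the
self-avoiding arcs `p : c → c'` of `Ω_δ` avoiding `β`, `β'` with `A p.support` (the map
`γ ↦ middle arc` is injective and `x_c^{|γ|} = x_c^{|β|+|β'|} x_c^{|p|}`). (ii) Gluing:
`x_c^{|β|+|β'|}` times the mass of all such arcs is at most the weight of the fibre (the map
`p ↦` the SAW with support `β ++ p.support ++ β'` is injective). [cite: DuminilCopinSmirnov2012, §2] -/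
theorem stub_arcFibre :
    ∀ (Ω : Set ℂ) (δ : ℝ) (a₀ b₀ : Site 2) (γ₀ : SAW.DomainSAW Ω δ a₀ b₀) (β α₀ β' : List (Site 2))
      (c c' : Site 2) (A : List (Site 2) → Prop),
      γ₀.walk.support = β ++ α₀ ++ β' → α₀.head? = some c → α₀.getLast? = some c' →
      (∑' γ : {γ : SAW.DomainSAW Ω δ a₀ b₀ // ∃ α : List (Site 2), γ.walk.support = β ++ α ++ β' ∧
            α.head? = some c ∧ α.getLast? = some c' ∧ A α},
          ENNReal.ofReal (SAW.criticalFugacity ^ γ.1.length) ≤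
        ENNReal.ofReal (SAW.criticalFugacity ^ (β.length + β'.length)) *
          ∑' p : {p : {p : (discreteDomainGraph Ω δ).Walk c c' //
              p.IsPath ∧ ∀ v ∈ p.support, v ∈ {v : Site 2 | v ∉ β ∧ v ∉ β'}} // A p.1.support},
            ENNReal.ofReal (SAW.criticalFugacity ^ p.1.1.length)) ∧
      (ENNReal.ofReal (SAW.criticalFugacity ^ (β.length + β'.length)) *
          ∑' p : {p : (discreteDomainGraph Ω δ).Walk c c' //
              p.IsPath ∧ ∀ v ∈ p.support, v ∈ {v : Site 2 | v ∉ β ∧ v ∉ β'}},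
            ENNReal.ofReal (SAW.criticalFugacity ^ p.1.length) ≤
        ∑' γ : {γ : SAW.DomainSAW Ω δ a₀ b₀ // ∃ α : List (Site 2), γ.walk.support = β ++ α ++ β' ∧
            α.head? = some c ∧ α.getLast? = some c'},
          ENNReal.ofReal (SAW.criticalFugacity ^ γ.1.length))  := by
  classical
  intro Ω δ a₀ b₀ γ₀ β α₀ β' c c' A hγ₀ hc hc'
  refine ⟨?_, ?_⟩
  · -- (i) cutting: `γ ↦ its middle arc` is a weight-factorising injection
    have hex : ∀ γ : {γ : SAW.DomainSAW Ω δ a₀ b₀ // ∃ α : List (Site 2),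
        γ.walk.support = β ++ α ++ β' ∧ α.head? = some c ∧ α.getLast? = some c' ∧ A α},
        ∃ p : {p : {p : (discreteDomainGraph Ω δ).Walk c c' //
            p.IsPath ∧ ∀ v ∈ p.support, v ∈ {v : Site 2 | v ∉ β ∧ v ∉ β'}} // A p.1.support},
          γ.1.walk.support = β ++ p.1.1.support ++ β' ∧
            γ.1.length = β.length + β'.length + p.1.1.length := by
      intro γ
      obtain ⟨α, hγ, hαc, hαc', hA⟩ := γ.2
      obtain ⟨p, hp, hpβ, hps, hlen⟩ := arcFibre_cut γ.1 hγ hαc hαc'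
      subst hps
      exact ⟨⟨⟨p, hp, hpβ⟩, hA⟩, hγ, hlen⟩
    choose Φ hΦs hΦl using hex
    have hinj : Function.Injective Φ := by
      intro γ₁ γ₂ h
      apply Subtype.ext
      apply SAW.DomainSAW.ext_support
      rw [hΦs γ₁, hΦs γ₂, h]
    have hw : ∀ γ, ENNReal.ofReal (SAW.criticalFugacity ^ γ.1.length) =
        ENNReal.ofReal (SAW.criticalFugacity ^ (β.length + β'.length)) *
          ENNReal.ofReal (SAW.criticalFugacity ^ (Φ γ).1.1.length) := by
      intro γ
      rw [hΦl γ, arcFibre_ofReal_pow_add (β.length + β'.length)]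
    rw [← ENNReal.tsum_mul_left]
    exact ENNReal.summable.tsum_le_tsum_of_inj Φ hinj (fun _ _ => zero_le)
      (fun γ => (hw γ).le) ENNReal.summable
  · -- (ii) gluing: `p ↦ the SAW with support β ++ p.support ++ β'` is a weight-factorising
    -- injection
    have hex : ∀ p : {p : (discreteDomainGraph Ω δ).Walk c c' //
        p.IsPath ∧ ∀ v ∈ p.support, v ∈ {v : Site 2 | v ∉ β ∧ v ∉ β'}},
        ∃ γ : {γ : SAW.DomainSAW Ω δ a₀ b₀ // ∃ α : List (Site 2),
            γ.walk.support = β ++ α ++ β' ∧ α.head? = some c ∧ α.getLast? = some c'},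
          γ.1.walk.support = β ++ p.1.support ++ β' ∧
            γ.1.length = β.length + β'.length + p.1.length := by
      rintro ⟨p, hp, hpβ⟩
      obtain ⟨γ, hγs, hγl⟩ := arcFibre_glue γ₀ hγ₀ hc hc' p hp hpβ
      refine ⟨⟨γ, p.support, hγs, ?_, ?_⟩, hγs, hγl⟩
      · rw [List.head?_eq_some_head p.support_ne_nil, SimpleGraph.Walk.head_support]
      · rw [List.getLast?_eq_some_getLast p.support_ne_nil, SimpleGraph.Walk.getLast_support]
    choose Ψ hΨs hΨl using hex
    have hinj : Function.Injective Ψ := by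
      intro p₁ p₂ h
      have e : β ++ p₁.1.support ++ β' = β ++ p₂.1.support ++ β' := by
        rw [← hΨs p₁, ← hΨs p₂, h]
      exact Subtype.ext (SimpleGraph.Walk.support_injective
        (List.append_cancel_left (List.append_cancel_right e)))
    have hw : ∀ p, ENNReal.ofReal (SAW.criticalFugacity ^ (β.length + β'.length)) *
        ENNReal.ofReal (SAW.criticalFugacity ^ p.1.length) =
          ENNReal.ofReal (SAW.criticalFugacity ^ (Ψ p).1.length) := by
      intro p
      rw [hΨl p, arcFibre_ofReal_pow_add (β.length + β'.length)]
    rw [← ENNReal.tsum_mul_left]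
    exact ENNReal.summable.tsum_le_tsum_of_inj Ψ hinj (fun _ _ => zero_le)
      (fun p => (hw p).le) ENNReal.summable

end Summit.CriticalPhenomena.SAWScalingLimit.Theorems

end
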